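import Literature.NumberTheory.QuadraticFields.ThreeTorsionMeanTwistedCount
import HarnessLib

/-!
# Taniguchi–Thorne, Thm 6 (3-torsion in progressions): the character-twisted two-term asymptotics as its two leaves

Topic `Literature/NumberTheory/QuadraticFields`; decomposition file (librarian, fact-decompose
`libsplit-37`, human 2026-08-16) for the named fact `tt_threeTorsion_sum_progression` of
`ThreeTorsionMean.lean` — T. Taniguchi, F. Thorne, *Secondary terms in counting functions for cubic
fields*, Duke Math. J. 162 (2013) 2451–2508 = arXiv:1102.2914, Thm. 6: for `(6a, m) = 1`,
`Σ_{0<±D<X, D ≡ a (m)} #Cl₃(D) = ((3 + C^±)/(π² m)) Π_{p∣m} (1 − p⁻²)⁻¹ X + K^±(m,a) X^{5/6} + O(X^{18/23+ε})`.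

Printed proof (§6.6, with §6.1 and §6.4 of the paper; text read, arXiv pp. 24–28): Thm. 6 is read
off, by orthogonality of Dirichlet characters `mod m`, from the CHARACTER-TWISTED two-term
asymptotics — Thm. 25 (the twisted count `M₃^±(X, χ)` of nowhere totally ramified cubic fields:
"Whenever `χ⁶ ≠ 1` [error term only] … When `χ⁶ = 1` … `M₃^±(X, 𝒮; r, χ) = δ(χ) C'^±(𝒮)/(2π²) X +
K'^±(𝒮, χ) (4L(1/3, χ)/(5Γ(2/3)³)) Π (…) X^{5/6} + O(X^{18/23+ε} N^{20/23})`") combined with the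
dictionary `Σ_D χ(D) #Cl₃(D) = Σ_D χ(D) + 2 M₃^±(X, χ)` (§6.1, Hasse) and the twisted count of
quadratic fields (Lemma 21 / (6.1)). The tree PROVES the orthogonality step and the constants
(`tt_threeTorsion_sum_progression_of_twisted_threeTorsion`, `ThreeTorsionMeanTwistedCount.lean`,
with `two_term_progression_of_twisted`, `totient_inv_mul_prod_eq`, and the interchangeability of the
`M₃`- and `#Cl₃`-forms, `twisted_two_term_iff_of_dictionary`), taking the twisted asymptotics as
four inline hypotheses (trivial / non-trivial character × sign). This file names them as the TWO
children of the decomposition (one per sign; named facts, D-0014), in the `#Cl₃`-form over the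
tree's carriers (`negFundDiscrs`, `posFundDiscrs`, `quadFieldThreeTorsion`, Mathlib's
`DirichletCharacter ℂ m`):

* `tt_twisted_threeTorsion_sum_neg` — for `m` prime to `6` and every `χ (mod m)`:
  `Σ_{-X<D<0} χ(D̄) #Cl₃(D) = δ(χ) (6/π²) Π_{p∣m} (1 + p⁻¹)⁻¹ X + K_χ X^{5/6} + O_{m,χ,ε}(X^{18/23+ε})`;
* `tt_twisted_threeTorsion_sum_pos` — the same over `0 < D < X` with `4/π²`;
* `tt_threeTorsion_sum_progression_holds_of : neg → pos → tt_threeTorsion_sum_progression` — PROVED.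

Faithfulness of the children: main term only for the trivial character (`δ(χ)`, as printed; for
`χ ≠ 1` with `χ⁶ = 1` the printed `X`-coefficient `δ(χ) C'^±/(2π²)` vanishes as well, the
`X^{5/6}`-coefficient `K_χ` — a sum over local specifications at `p ∣ m` of Thm. 25's
`K'^±(𝒮, χ)`-terms, non-zero only for sextic `χ` — is existential here); the constant
`(6/π²) Π_{p∣m}(1 + p⁻¹)⁻¹` is `2 ·` (density of fundamental discriminants prime to `m`), i.e.
Thm. 6's `(6/(π² m)) Π (1 − p⁻²)⁻¹` summed over the `φ(m)` classes; error `O(X^{18/23+ε})` per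
`(m, χ, ε)` (print: uniform `O(X^{18/23+ε} N^{20/23})`) — weaker than print. Imprimitive characters
are included (`χ(D̄) = 0` unless `(D, m) = 1`: a local specification "unramified at `p ∣ m`" in
Thm. 25).

## References

* [TaniguchiThorne2013] T. Taniguchi, F. Thorne, Duke Math. J. 162 (2013), Thm. 6 (p. 4 of
  arXiv:1102.2914), §6.1 (eq. (6.1), `M₃`), §6.4 (progressions and characters), Thm. 25 and §6.6
  ("We readily deduce Theorem 6").
-/

noncomputable section

open Finset

namespace Literature.NumberTheory.QuadraticFields

open Classical in
/-- **Taniguchi–Thorne 2013, Thm. 25 with §6.1/§6.6 — character-twisted 3-torsion sums over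
imaginary quadratic fields (named fact).** For every modulus `m` prime to `6` and every Dirichlet
character `χ (mod m)` there is `K_χ ∈ ℂ` such that for every `ε > 0`,
`Σ_{-X<D<0, D fundamental} χ(D̄) #Cl(ℚ(√D))[3] = δ(χ) · (6/π²) Π_{p ∣ m} (1 + p⁻¹)⁻¹ · X + K_χ X^{5/6} + O(X^{18/23+ε})`
(`δ(χ) = 1` if `χ` is trivial, `0` otherwise). In print this is Thm. 25 for
`M₃⁻(X, 𝒮; 1, χ)` summed over the unramified local specifications at `p ∣ m` ("Whenever `χ⁶ ≠ 1`,
… `O(X^{18/23+ε} N^{20/23})`. When `χ⁶ = 1` … `δ(χ) C'⁻(𝒮)/(2π²) X + K'⁻(𝒮, χ) … X^{5/6} +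
O(X^{18/23+ε} N^{20/23})`") together with `Σ χ #Cl₃ = Σ χ + 2M₃⁻(X, χ)` (§6.1) and the twisted
count of quadratic fields (Lemma 21, (6.1)); §6.6: "We readily deduce Theorem 6". Rendering:
`D` over `negFundDiscrs X` (`-X < D < 0`), `#Cl₃(D) = quadFieldThreeTorsion D`, `χ(D̄)` through
`ℤ → ZMod m`; the `X^{5/6}`-coefficient existential; constants per `(m, χ, ε)` — weaker than print.
This is the pair of hypotheses `hneg1`/`hneg` of
`tt_threeTorsion_sum_progression_of_twisted_threeTorsion`. Users take
`(h : tt_twisted_threeTorsion_sum_neg)`.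
[cite: TaniguchiThorne2013, Thm. 25 with §6.1 (6.1) and §6.6 (deduction of Thm. 6)] -/
def tt_twisted_threeTorsion_sum_neg : Prop :=
  ∀ m : ℕ, m.Coprime 6 → ∀ χ : DirichletCharacter ℂ m, ∃ K : ℂ, ∀ ε : ℝ, 0 < ε → ∃ C : ℝ,
    ∀ X : ℕ, 1 ≤ X →
      ‖(∑ D ∈ negFundDiscrs X, χ (D : ZMod m) * (quadFieldThreeTorsion D : ℂ))
          - (if χ = 1 then
              (((6 / Real.pi ^ 2 * (∏ p ∈ m.primeFactors, (1 + 1 / (p : ℝ))⁻¹) * X : ℝ) : ℂ))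
            else 0)
          - K * (((X : ℝ) ^ ((5 : ℝ) / 6) : ℝ) : ℂ)‖ ≤ C * (X : ℝ) ^ ((18 : ℝ) / 23 + ε)

open Classical in
/-- **Taniguchi–Thorne 2013, Thm. 25 with §6.1/§6.6 — character-twisted 3-torsion sums over real
quadratic fields (named fact).** As `tt_twisted_threeTorsion_sum_neg`, over `0 < D < X`
(`posFundDiscrs X`) with main term `δ(χ) · (4/π²) Π_{p ∣ m} (1 + p⁻¹)⁻¹ · X` (`(3 + C⁺)/π²`,
`C⁺ = 1`). Users take `(h : tt_twisted_threeTorsion_sum_pos)`.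
[cite: TaniguchiThorne2013, Thm. 25 with §6.1 (6.1) and §6.6 (deduction of Thm. 6)] -/
def tt_twisted_threeTorsion_sum_pos : Prop :=
  ∀ m : ℕ, m.Coprime 6 → ∀ χ : DirichletCharacter ℂ m, ∃ K : ℂ, ∀ ε : ℝ, 0 < ε → ∃ C : ℝ,
    ∀ X : ℕ, 1 ≤ X →
      ‖(∑ D ∈ posFundDiscrs X, χ (D : ZMod m) * (quadFieldThreeTorsion D : ℂ))
          - (if χ = 1 then
              (((4 / Real.pi ^ 2 * (∏ p ∈ m.primeFactors, (1 + 1 / (p : ℝ))⁻¹) * X : ℝ) : ℂ))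
            else 0)
          - K * (((X : ℝ) ^ ((5 : ℝ) / 6) : ℝ) : ℂ)‖ ≤ C * (X : ℝ) ^ ((18 : ℝ) / 23 + ε)

/-- **Decomposition of `tt_threeTorsion_sum_progression`** (Taniguchi–Thorne, Thm. 6) from its two
children `tt_twisted_threeTorsion_sum_neg`, `tt_twisted_threeTorsion_sum_pos`, by the tree's theorem
`tt_threeTorsion_sum_progression_of_twisted_threeTorsion` (orthogonality over `χ (mod m)` and
`φ(m)⁻¹ Π_{p∣m} (1 + p⁻¹)⁻¹ = m⁻¹ Π_{p∣m} (1 − p⁻²)⁻¹`, proved).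
[cite: TaniguchiThorne2013, §6.6 (deduction of Theorem 6 from Theorem 25)] -/
theorem tt_threeTorsion_sum_progression_holds_of (hneg : tt_twisted_threeTorsion_sum_neg)
    (hpos : tt_twisted_threeTorsion_sum_pos) : tt_threeTorsion_sum_progression := by
  classical
  refine tt_threeTorsion_sum_progression_of_twisted_threeTorsion ?_ ?_ ?_ ?_
  · intro m hm
    obtain ⟨K, hK⟩ := hneg m hm 1
    refine ⟨K, fun ε hε => ?_⟩
    obtain ⟨C, hC⟩ := hK ε hε
    refine ⟨C, fun X hX => ?_⟩
    have h := hC X hX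
    rwa [if_pos rfl] at h
  · intro m hm χ hχ
    obtain ⟨K, hK⟩ := hneg m hm χ
    refine ⟨K, fun ε hε => ?_⟩
    obtain ⟨C, hC⟩ := hK ε hε
    refine ⟨C, fun X hX => ?_⟩
    have h := hC X hX
    rwa [if_neg hχ, sub_zero] at h
  · intro m hm
    obtain ⟨K, hK⟩ := hpos m hm 1
    refine ⟨K, fun ε hε => ?_⟩
    obtain ⟨C, hC⟩ := hK ε hε
    refine ⟨C, fun X hX => ?_⟩
    have h := hC X hX
    rwa [if_pos rfl] at h
  · intro m hm χ hχ
    obtain ⟨K, hK⟩ := hpos m hm χ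
    refine ⟨K, fun ε hε => ?_⟩
    obtain ⟨C, hC⟩ := hK ε hε
    refine ⟨C, fun X hX => ?_⟩
    have h := hC X hX
    rwa [if_neg hχ, sub_zero] at h

end Literature.NumberTheory.QuadraticFields

end
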